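import Summits.QuantumFields.BalabanUV.T4Continuum.Support.TermwiseHolderExponent
import Literature.MathematicalPhysics.QuantumFieldTheory.Balaban1983to89.B11HolderComplex

/-!
# TermwiseHolder (part 5) — the background binder IN THE PRINTED HÖLDER CURRENCY: the third `LocReg` radius is
dominated by the `(1,β)`-Hölder norm of [Balaban1985BackgroundPropagators] (3.40) read at `U₀ = 1`

HONEST FRAMING, PLACEMENT, ABSOLUTE RULE: see part 1/4 (`Support/TermwiseHolder`), whose module docstring governs
this file: FIXED FINITE four-torus, rung (B)+1, conditional; NOT infinite volume, NOT a mass gap, NOT the Clay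
statement; the spine estimate NE7 is NOT PRINTED in [Balaban1984PropagatorsI]–[Balaban1989LargeFieldII] and NOT
proved here; every hypothesis is a NAMED binder.  Cell `pub-balaban`, lineage `b2b-balaban-t4-ne7-p1` (generation 16),
record `t4/T4-EST-NE7-P1.md` §20; the printed sentences below are quoted for CONTEXT (the located READING of a norm
symbol), never used as facts — the manuscripts are under audit.

THE READING THIS PART TYPES (cell GAPS A-ne7p1g15-1, settled by generation 16 from the page renders).  Part 4 typed the
located background input `hAreg`/`hBreg` of the term-wise chain with third `LocReg` radius `a₂ε₁L^{−2K}(L^{−β₀})^K`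
(ALL mixed second differences of the local potential), naming as its printed LOCUS the Hölder clause of
[Balaban1985Variational] Thm 1 (9) p. 279: *"U^{u^{−1}} = e^{iηA}, |A| < B₃Mε₁(L^jη)^{−1}, |∇^ηA| < B₃Mε₁(L^jη)^{−2},
‖A‖_{1,β} < B₄(β₀)Mε₁(L^jη)^{−2−β} for 0 ≤ β ≤ β₀ = 1, (9)"* (derivable for `β₀ < 1` only: `B11Holder9`).  Whether
the symbol `‖·‖_{1,β}` dominates those second differences was flagged as a reading.  The symbol is defined in
[Balaban1985BackgroundPropagators] p. 397, (3.39)–(3.40), verbatim: *"|A| = max_μ sup_x |A_μ(x)|, |∇A| = max_{μ,ν}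
sup_x |(D_μA_ν)(x)|, (3.39) and the Hölder norms ‖A‖_α = max_μ sup_{x,x′:|x−x′|≤1} |x′ − x|^{−α} |R(U(Γ_{x,x′}))A_μ(x′)
− A_μ(x)|, (3.40) ‖A‖_{1,α} = ‖∇A‖_α = max_{μ,ν} sup_{x,x′:|x−x′|≤1} |x′ − x|^{−α} |R(U(Γ_{x,x′}))(D_μA_ν)(x′) −
(D_μA_ν)(x)|, where Γ_{x,x′} is a shortest contour connecting points x and x′. It is understood that the η-scale is
used in the above definitions."* ([Balaban1985RegularSpaces] p. 76: *"This paper is based on the definitions and the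
results of [1, 3, 4]"*, its [4] p. 102 = [Balaban1985BackgroundPropagators]; [Balaban1985Variational] p. 301 applies
[Balaban1985RegularSpaces] Thm 2 *"to the pair of configurations U′_k, 1 (in place of U′U₀, U₀ in that paper)"*, so in
(9) the configuration of the covariant derivative and of the transport is `U₀ = 1`: `R(U₀(Γ)) = id`, `D_μ = ∇^η_μ`.)
CONSEQUENCE (elementary, the content of `HolderReg.locReg` below): for η-lattice neighbours `x′ = x + ηe_λ` (distance
`η ≤ 1`) the quotient gives `|∇^η_μA_ν(x + ηe_λ) − ∇^η_μA_ν(x)| ≤ ‖A‖_{1,β}·η^β` for ALL `λ, μ, ν`, i.e. in the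
unit-index variables `B = ηA` of parts 1–4 (`Δ_μB_ν = η²∇^η_μA_ν`): `‖Δ_λΔ_μB_ν‖ ≤ η^{2+β}·‖A‖_{1,β}`.  With
`η = L^{−K}` and the (9)-shape bound `‖A‖_{1,β₀} ≤ a₂ε₁` at the top level (`L^jη = 1`) this IS part 4's third radius
`a₂ε₁((L^K)⁻¹)²(L^{−β₀})^K` (`B11Holder9.rate_pow_eq`).  READING CONFIRMED; no transport correction arises at
`U₀ = 1`.  What is NOT asserted (unchanged, BY NAME): that the two runs' level-`K` backgrounds of the cell's T⁴ tower ARE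
such local potentials about every site a good Wilson term uses (the class of cubes □ of p. 278–279, the identification of
the background variable with `U_k(V)` — (repr)-class), and `β₀ < 1` for derivability.

Contents: §10 the predicate `HolderReg V z R η c₀ c₁ β c₂` (local gauge potential `B` on the `l¹`-ball of radius `R`
about `z`, `‖B‖ ≤ ηc₀`, `‖Δ_μB_ν‖ ≤ η²c₁`, and `‖A‖_{1,β} ≤ c₂` in the sense of (3.40) at `U₀ = 1`, typed with the
tree's pair-seminorm predicate `B11HolderComplex.HolderOn` BY NAME on the family of first differences with constant
`η²c₂`, pairs of the ball at physical distance `η·|x′ − x|₁ ≤ 1`); `HolderReg.mono`, `holderReg_one`; THE DICTIONARY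
`HolderReg.locReg` (`HolderReg V z (R+1) η … ∧ η ≤ 1 ⇒ LocReg V z R (ηc₀) (η²c₁) (η²c₂·η^β)`) and its tower form
`HolderReg.locReg_level` (`η = (L^K)⁻¹`: exactly part 4's three radii).  §11 part 4's producer and ledger theorem with
`hAreg`/`hBreg` REPLACED by the Hölder-currency binders `hA9`/`hB9` (ONE CALL each).  §12 toy (non-vacuity).
Elementary lattice bookkeeping ([folklore]); NOT NE7, NOT summit progress.
-/

noncomputable section

open Finset MeasureTheory _root_.Filter _root_.Topology NormedSpace
open scoped BigOperators Matrix.Norms.L2Operator InnerProductSpace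

namespace Summit.QuantumFields.BalabanUV.T4Continuum.TermwiseHolder

open Literature.MathematicalPhysics.QuantumFieldTheory.Balaban1983to89
open T4OutputRate T4RecentScale T4GoodClassBudget T4CauchySum T4Crossover T4TowerRateComposition T4TowerRateDischarge
open T4BoundaryCarrier (BFunctional atFl NE9Fl LipBackgroundFl NE5B)
open T4TermwiseBudget T4TermwiseDeviation T4TermwiseCurrency T4TermwiseBoundary T4TermwiseResidual T4TermwiseAction
open T4TermwiseClassical T4TermwiseQuartic
open T4TermwiseInstantiate (cBCH cBCH_nonneg cSZ cSZ_nonneg)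
open T4TermwiseOscillation (cOSC)
open B7Prop1Explicit B7Prop2Explicit T4TermwiseBCH T4TermwiseTorus T4TermwiseUN T4TermwiseChainUN
open TermwiseBackground B11Holder9 B11HolderComplex

/-! ## §10 The regularity predicate in the printed Hölder currency and its dictionary to `LocReg` -/

section HolderCurrency
variable {d : ℕ} {𝔸 : Type*} [NormedRing 𝔸] [NormOneClass 𝔸] [NormedAlgebra ℂ 𝔸] [CompleteSpace 𝔸]

/-- **Local gauge potential with the three (9)-type bounds, the third in the `(1,β)`-HÖLDER CURRENCY of
[Balaban1985BackgroundPropagators] (3.40) at `U₀ = 1`.**  `HolderReg V z R η c₀ c₁ β c₂`: there are norm-bounded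
gauge units `u` and an algebra-valued bond function `B` (`= ηA` in unit-index variables, `η` the lattice spacing) with
`V(x,κ) = u(x)·e^{B(x,κ)}·u(x+e_κ)⁻¹` on the `l¹`-ball of radius `R` about `z`; on that ball `‖B‖ ≤ η·c₀`
(*"|A| < c₀"*), `‖B(x+e_μ,ν) − B(x,ν)‖ ≤ η²·c₁` (*"|∇^ηA| < c₁"*, `Δ_μB_ν = η²∇^η_μA_ν`); and the family of first
differences `x ↦ (Δ_μB_ν(x))_{μ,ν}` is `(η²c₂, β)`-Hölder in the sense of the tree's `HolderOn` over the pairs `x, x′`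
of the ball at physical distance `η·|x′ − x|₁ ≤ 1` (*"‖A‖_{1,β} ≤ c₂"*: sup norm over `(μ,ν)` = the printed `max_{μ,ν}`;
plain quotient, no transport, as at `U₀ = 1`; the `l¹` lattice distance dominates the Euclidean one, so this clause is
implied by the Euclidean-distance reading of `|x − x′|`).  A HYPOTHESIS SHAPE on a configuration, never asserted of
any particular one. [folklore] -/
def HolderReg (V : B7Prop1Explicit.Site d → Fin d → 𝔸ˣ) (z : B7Prop1Explicit.Site d) (R : ℕ)
    (η c₀ c₁ β c₂ : ℝ) : Prop :=
  ∃ (u : B7Prop1Explicit.Site d → 𝔸ˣ) (B : B7Prop1Explicit.Site d → Fin d → 𝔸),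
    (∀ x, u x ∈ U1 𝔸) ∧
    (∀ x κ, l1 (x - z) ≤ R → V x κ = gaugeAct u (fun y ι => expUnit (B y ι)) x κ) ∧
    (∀ x κ, l1 (x - z) ≤ R → ‖B x κ‖ ≤ η * c₀) ∧
    (∀ x κ ι, l1 (x - z) ≤ R → ‖B (x + e ι) κ - B x κ‖ ≤ η ^ 2 * c₁) ∧
    HolderOn (fun x x' => η * (l1 (x' - x) : ℝ)) β
      (fun x x' => (l1 (x - z) ≤ R ∧ l1 (x' - z) ≤ R) ∧ η * (l1 (x' - x) : ℝ) ≤ 1)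
      (fun x (p : Fin d × Fin d) => B (x + e p.1) p.2 - B x p.2) (η ^ 2 * c₂)

/-- `HolderReg` is monotone in the three constants (for `η ≥ 0`). [folklore] -/
theorem HolderReg.mono {V : B7Prop1Explicit.Site d → Fin d → 𝔸ˣ} {z : B7Prop1Explicit.Site d} {R : ℕ}
    {η c₀ c₁ β c₂ c₀' c₁' c₂' : ℝ} (h : HolderReg V z R η c₀ c₁ β c₂) (hη : 0 ≤ η) (h₀ : c₀ ≤ c₀')
    (h₁ : c₁ ≤ c₁') (h₂ : c₂ ≤ c₂') : HolderReg V z R η c₀' c₁' β c₂' := by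
  obtain ⟨u, B, hu, hrep, hB₀, hB₁, hH⟩ := h
  refine ⟨u, B, hu, hrep, fun x κ hx => (hB₀ x κ hx).trans (mul_le_mul_of_nonneg_left h₀ hη),
    fun x κ ι hx => (hB₁ x κ ι hx).trans (mul_le_mul_of_nonneg_left h₁ (sq_nonneg η)), ?_⟩
  exact hH.mono (fun x x' => by positivity) (mul_le_mul_of_nonneg_left h₂ (sq_nonneg η))

/-- The constant configuration `V ≡ 1` is `HolderReg` about every site with every radius, spacing and exponent and
constants `(0,0,0)` (`u ≡ 1`, `B ≡ 0`): non-vacuity of the predicate. [folklore] -/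
theorem holderReg_one (z : B7Prop1Explicit.Site d) (R : ℕ) (η β : ℝ) :
    HolderReg (fun (_ : B7Prop1Explicit.Site d) (_ : Fin d) => (1 : 𝔸ˣ)) z R η 0 0 β 0 := by
  have h0 : expUnit (0 : 𝔸) = 1 := Units.ext (by simp)
  refine ⟨fun _ => 1, fun _ _ => 0, fun _ => Subgroup.one_mem _, fun x κ _ => by simp [gaugeAct, h0], by simp,
    by simp, ?_⟩
  intro x x' _
  simp

/-- **THE DICTIONARY (one site).**  `HolderReg` on the ball of radius `R + 1` with `0 ≤ η ≤ 1` gives part 2's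
`LocReg` on the ball of radius `R` with radii `η·c₀`, `η²·c₁`, `η²·c₂·η^β` (`η ≤ 1`): the size and first-difference clauses by
restriction, and EVERY mixed second difference `Δ_{ι'}Δ_ιB_κ(x) = (Δ_ιB_κ)(x + e_{ι'}) − (Δ_ιB_κ)(x)` from the Hölder
clause at the lattice-neighbour pair `(x, x + e_{ι'})` (both in the larger ball, physical distance `η·1 ≤ 1`), whose
quotient bound `η²c₂·(η·1)^β` dominates the `(ι, κ)` component of the sup norm.  This is the kernel form of the reading
*"‖A‖_{1,β} controls all mixed second differences at lattice distance η"*. [folklore] -/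
theorem HolderReg.locReg {V : B7Prop1Explicit.Site d → Fin d → 𝔸ˣ} {z : B7Prop1Explicit.Site d} {R : ℕ}
    {η c₀ c₁ β c₂ : ℝ} (h : HolderReg V z (R + 1) η c₀ c₁ β c₂) (hη1 : η ≤ 1) :
    LocReg V z R (η * c₀) (η ^ 2 * c₁) (η ^ 2 * c₂ * η ^ β) := by
  obtain ⟨u, B, hu, hrep, hB₀, hB₁, hH⟩ := h
  have hR : ∀ y : B7Prop1Explicit.Site d, l1 (y - z) ≤ R → l1 (y - z) ≤ R + 1 := fun y hy => by omega
  refine ⟨u, B, hu, fun x κ hx => hrep x κ (hR x hx), fun x κ hx => hB₀ x κ (hR x hx),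
    fun x κ ι hx _ => hB₁ x κ ι (hR x hx), fun x κ ι ι' hx _ => ?_⟩
  -- the neighbour pair `(x, x + e ι')` lies in the ball of radius `R + 1`, at physical distance `η`
  have hdisp : x + e ι' - x = e ι' := by abel
  have hl1 : (l1 (x + e ι' - x) : ℝ) = 1 := by rw [hdisp, l1_e]; simp
  have hx' : l1 (x + e ι' - z) ≤ R + 1 := by
    have := l1_add_le (x - z) (e ι')
    rw [l1_e] at this
    have hxz : x - z + e ι' = x + e ι' - z := by abel
    rw [hxz] at this
    omega
  have hpair := hH x (x + e ι') ⟨⟨hR x hx, hx'⟩, by rw [hl1, mul_one]; exact hη1⟩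
  dsimp only at hpair
  rw [hl1, mul_one] at hpair
  -- the `(ι, κ)` component of the sup norm
  have hcomp := (norm_le_pi_norm ((fun (p : Fin d × Fin d) => B (x + e ι' + e p.1) p.2 - B (x + e ι') p.2) -
      (fun (p : Fin d × Fin d) => B (x + e p.1) p.2 - B x p.2)) (ι, κ)).trans hpair
  have hxe : x + e ι' + e ι = x + e ι + e ι' := add_right_comm _ _ _
  simpa [Pi.sub_apply, hxe] using hcomp

/-- **THE DICTIONARY AT LEVEL `K` OF A TOWER** (`η = (L^K)⁻¹`, `1 ≤ L`): `HolderReg V z 6 (L^K)⁻¹ (a₀ε₁) (a₁ε₁) β₀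
(a₂ε₁)` gives EXACTLY part 4's located binder `LocReg V z 5 (a₀ε₁(L^K)⁻¹) (a₁ε₁((L^K)⁻¹)²)
(a₂ε₁((L^K)⁻¹)²(L^{−β₀})^K)` (`B11Holder9.rate_pow_eq`: `((L^K)⁻¹)^{β₀} = (L^{−β₀})^K`).  In the (9) numbers at the
top level `j = k` (`L^jη = 1`): `a₀ = a₁ = B₃M`, `a₂ = B₄(β₀)M` — a dictionary, NOT an assertion about any
background. [folklore] -/
theorem HolderReg.locReg_level {V : B7Prop1Explicit.Site d → Fin d → 𝔸ˣ} {z : B7Prop1Explicit.Site d} {L : ℕ}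
    (hL : 1 ≤ L) (K : ℕ) {a₀ a₁ a₂ ε₁ β₀ : ℝ}
    (h : HolderReg V z 6 (((L : ℝ) ^ K)⁻¹) (a₀ * ε₁) (a₁ * ε₁) β₀ (a₂ * ε₁)) :
    LocReg V z 5 (a₀ * ε₁ * ((L : ℝ) ^ K)⁻¹) (a₁ * ε₁ * (((L : ℝ) ^ K)⁻¹) ^ 2)
      (a₂ * ε₁ * (((L : ℝ) ^ K)⁻¹) ^ 2 * ((L : ℝ) ^ (-β₀)) ^ K) := by
  have hL1 : (1 : ℝ) ≤ L := by exact_mod_cast hL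
  have hLpos : (0 : ℝ) < L := by linarith
  have hη1 : ((L : ℝ) ^ K)⁻¹ ≤ 1 := inv_le_one_of_one_le₀ (one_le_pow₀ hL1)
  have h' := h.locReg hη1
  rw [rate_pow_eq hLpos β₀ K] at h'
  exact h'.mono (le_of_eq (by ring)) (le_of_eq (by ring)) (le_of_eq (by ring))

end HolderCurrency

/-! ## §11 Part 4's producer and ledger theorem with the background binder in the printed Hölder currency -/

section HolderUN
variable {n : Type*} [Fintype n] [DecidableEq n] [Nonempty n]
variable {ι : Type} {σ : Type*} [DecidableEq σ] {l₀ : ℝ} {T : ℕ → Finset σ} {Bad : ℕ → ℝ → Finset σ} {Adm : Set ι}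

/-- **(U)(L) FOR `U(N)` WILSON TERMS, THE BACKGROUND BINDER IN THE PRINTED HÖLDER CURRENCY** — part 4's
`interpolation_averaging_UN_of_locRegHolder` with its located input `hAreg`/`hBreg` (three `LocReg` radii, the third
`a₂ε₁L^{−2K}(L^{−β₀})^K` = all mixed second differences) REPLACED by `hA9`/`hB9`: at every level `K`, on the good
class, about every site, the two runs' backgrounds are `HolderReg` at spacing `(L^K)⁻¹` with the (9)-type constants
`(a₀ε₁, a₁ε₁)` for `|A|`, `|∇^ηA|` and `a₂ε₁` for the `(1,β₀)`-Hölder norm of (3.40) at `U₀ = 1` — ONE CALL, the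
three radii DERIVED by `HolderReg.locReg_level`.  Every other hypothesis BY NAME and verbatim (`hAU`/`hBU`, `0 < β₀ ≤ 1`,
`0 ≤ ε₁ ≤ 1`, the smallness `20480·L²·cReg·ε₁ ≤ 1`, (repr) `hreprU`/`hreprL`, `2 ≤ M`, `2 ≤ L`, genuine planes); same
OUTPUT (majorants `M⁴·dUP … (K ↦ (L^{−β₀})^K) K`, `M⁴·dLN …`, nonnegative and summable).  Whether the T⁴ tower's
backgrounds satisfy `hA9`/`hB9` is the background-regularity INPUT of NE7 — NOT PRINTED for the two runs as used here,
NOT asserted.  NOT NE7, NOT Clay. [folklore] -/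
theorem interpolation_averaging_UN_of_holderReg {Y YA : Type*} {g : ℕ → ℝ → σ → ι → YA → ℝ}
    {f₁ : ℕ → ℝ → σ → ι → Y → ℝ} {Q : ℕ → ℝ → σ → ι → Y → YA} {yA yB : ℕ → ℝ → σ → ι → Y}
    {xA : ℕ → ℝ → σ → ι → YA}
    (M L : ℕ) (hM : 2 ≤ M) (hL : 2 ≤ L) (planes : Finset (Fin 4 × Fin 4)) (hplanes : ∀ P ∈ planes, P.1 ≠ P.2)
    (VA VB : ℕ → ℝ → σ → ι → (B7Prop1Explicit.Site 4 → Fin 4 → (Matrix n n ℂ)ˣ))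
    {a₀ a₁ a₂ ε₁ β₀ : ℝ}
    (ha₀ : 0 ≤ a₀) (ha₁ : 0 ≤ a₁) (ha₂ : 0 ≤ a₂) (hε₁1 : ε₁ ≤ 1)
    (hsmall : 20480 * (L : ℝ) ^ 2 * (cReg a₀ a₁ * ε₁) ≤ 1)
    (hβ₀ : 0 < β₀) (hβ₀1 : β₀ ≤ 1)
    (hAU : ∀ K t, |t| ≤ l₀ → ∀ τ ∈ T K \ Bad K t, ∀ v ∈ Adm,
      (∀ x κ, VA K t τ v x κ ∈ unitaryUnits (Matrix n n ℂ)) ∧ IsPeriodic (M * L ^ K * L) (VA K t τ v))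
    (hBU : ∀ K t, |t| ≤ l₀ → ∀ τ ∈ T K \ Bad K t, ∀ v ∈ Adm,
      (∀ x κ, VB K t τ v x κ ∈ unitaryUnits (Matrix n n ℂ)) ∧ IsPeriodic (M * L ^ K * L) (VB K t τ v))
    (hA9 : ∀ K t, |t| ≤ l₀ → ∀ τ ∈ T K \ Bad K t, ∀ v ∈ Adm, ∀ z : B7Prop1Explicit.Site 4,
      HolderReg (VA K t τ v) z 6 (((L : ℝ) ^ K)⁻¹) (a₀ * ε₁) (a₁ * ε₁) β₀ (a₂ * ε₁))
    (hB9 : ∀ K t, |t| ≤ l₀ → ∀ τ ∈ T K \ Bad K t, ∀ v ∈ Adm, ∀ z : B7Prop1Explicit.Site 4,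
      HolderReg (VB K t τ v) z 6 (((L : ℝ) ^ K)⁻¹) (a₀ * ε₁) (a₁ * ε₁) β₀ (a₂ * ε₁))
    (hreprU : ∀ K t, |t| ≤ l₀ → ∀ τ ∈ T K \ Bad K t, ∀ v ∈ Adm,
      f₁ K t τ v (yA K t τ v) = ∑ x ∈ pbox planes (M * L ^ K * L), eN (phiU (VA K t τ v) x) ∧
        g K t τ v (xA K t τ v) = ∑ y ∈ pbox planes (M * L ^ K), eN (psiU L (VA K t τ v) y))
    (hreprL : ∀ K t, |t| ≤ l₀ → ∀ τ ∈ T K \ Bad K t, ∀ v ∈ Adm,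
      f₁ K t τ v (yB K t τ v) = ∑ x ∈ pbox planes (M * L ^ K * L), eN (phiU (VB K t τ v) x) ∧
        g K t τ v (Q K t τ v (yB K t τ v)) = ∑ y ∈ pbox planes (M * L ^ K), eN (psiU L (VB K t τ v) y))
    (hε₁ : 0 ≤ ε₁) :
    (∀ K t, |t| ≤ l₀ → ∀ τ ∈ T K \ Bad K t, ∀ v ∈ Adm,
      f₁ K t τ v (yA K t τ v) - g K t τ v (xA K t τ v)
        ≤ (M : ℝ) ^ 4 * dUP (Fintype.card n) L planes.card (cReg a₀ a₁) (cOscReg L a₀ a₁ a₂) ε₁ (fun K => ((L : ℝ) ^ (-β₀)) ^ K) K) ∧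
    (∀ K t, |t| ≤ l₀ → ∀ τ ∈ T K \ Bad K t, ∀ v ∈ Adm,
      g K t τ v (Q K t τ v (yB K t τ v)) - f₁ K t τ v (yB K t τ v)
        ≤ (M : ℝ) ^ 4 * dLN (Fintype.card n) L planes.card (cReg a₀ a₁) ε₁ K) ∧
    (∀ K, 0 ≤ dUP (Fintype.card n) L planes.card (cReg a₀ a₁) (cOscReg L a₀ a₁ a₂) ε₁ (fun K => ((L : ℝ) ^ (-β₀)) ^ K) K) ∧
    (∀ K, 0 ≤ dLN (Fintype.card n) L planes.card (cReg a₀ a₁) ε₁ K) ∧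
    Summable (dUP (Fintype.card n) L planes.card (cReg a₀ a₁) (cOscReg L a₀ a₁ a₂) ε₁
      (fun K => ((L : ℝ) ^ (-β₀)) ^ K)) ∧
    Summable (dLN (Fintype.card n) L planes.card (cReg a₀ a₁) ε₁) := by
  have hL1 : 1 ≤ L := le_trans one_le_two hL
  exact interpolation_averaging_UN_of_locRegHolder (g := g) (f₁ := f₁) (Q := Q) (yA := yA) (yB := yB) (xA := xA)
    M L hM hL planes hplanes VA VB ha₀ ha₁ ha₂ hε₁1 hsmall hβ₀ hβ₀1 hAU hBU
    (fun K t ht τ hτ v hv z => (hA9 K t ht τ hτ v hv z).locReg_level hL1 K)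
    (fun K t ht τ hτ v hv z => (hB9 K t ht τ hτ v hv z).locReg_level hL1 K) hreprU hreprL hε₁

end HolderUN

section Ledger


variable {n : Type*} [Fintype n] [DecidableEq n] [Nonempty n]
variable {C : T4BoundaryCarrier.Carriers} {ι : Type} [MeasurableSpace ι] {σ : Type*} [DecidableEq σ] {l₀ vol : ℝ}
  {T : ℕ → Finset σ} {Bad : ℕ → ℝ → Finset σ} {A B : ℕ → ℝ → σ → ℝ} {μ : ℕ → ℝ → σ → Measure ι}
  {fac bfac rfac : ℕ → ℝ → σ → Finset C.Dom} {Adm : Set ι} {EA : Functional C.toCarriers C.BgA}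
  {EB : Functional C.toCarriers C.BgB} {BA : BFunctional C C.BgA} {BB : BFunctional C C.BgB}
  {RA : Functional C.toCarriers C.BgA} {RB : Functional C.toCarriers C.BgB}
  {κ θ' Cr EB₀ CrR R₁ b β' w₀ : ℝ} {κ₀ : ℕ} {gA gB : ℕ → ℕ → ℝ} {gfA gfB : ℕ → ℝ} {gsA gsB : ℕ → ℕ → ℝ}
  {uA : ℕ → ι → C.BgA} {uB : ℕ → ι → C.BgB} {oneA : C.BgA} {oneB : C.BgB}
  {pend : ℕ → ℝ → σ → ι → C.Fl} {nA nB aA aB wA wB γA γB : ℕ → ℝ → σ → ι → ℝ} {qA qB : ℕ → ℝ}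
  {κ₁ S : ℕ → ℝ → σ → ℕ → ℝ} {cW RW : ℕ → ℝ → σ → ℝ} {rw sw rγ zA zB c₀ : ℕ → ℝ} {Cw E a Λ Cl : ℝ}

/-- **THE GOOD-CLASS HALF WITH `Summable δ⁗` FOR G = U(N) WILSON TERMS, THE BACKGROUND BINDER IN THE PRINTED HÖLDER
CURRENCY** — part 4's ledger theorem `goodClause_summable_UN_of_locRegHolder` with `hAreg`/`hBreg` REPLACED by
`hA9`/`hB9` (`HolderReg` at spacing `(L^K)⁻¹`, constants `(a₀ε₁, a₁ε₁, a₂ε₁)`, exponent `β₀`: the `|A|`, `|∇^ηA|` and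
`‖A‖_{1,β₀}` bounds of the (9)-shape read with (3.40) at `U₀ = 1`), ONE CALL; every other ledger binder carried BY
NAME and VERBATIM (none discharged) — the flow window (0.31) of [Balaban1987RG1] sits in `h031A`/`h031B`, the upstream
ledger kinds, (repr), `hAU`/`hBU`, `hMvol`, the smallness.  OUTPUT unchanged: the good clause with `δ⁗` whose action-kind
share is `w₀·(dUP … (K ↦ (L^{−β₀})^K) K + dLN …)`, and `Summable δ⁗`.  No print is used as a fact; nothing printed is
asserted; NOT NE7, NOT Clay. [folklore] -/
theorem goodClause_summable_UN_of_holderReg {Y YA : Type*} {Sfib : ℕ → ℝ → σ → ι → Set Y}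
    {SfibA : ℕ → ℝ → σ → ι → Set YA} {g : ℕ → ℝ → σ → ι → YA → ℝ} {f₁ : ℕ → ℝ → σ → ι → Y → ℝ}
    {Q : ℕ → ℝ → σ → ι → Y → YA} {yA yB : ℕ → ℝ → σ → ι → Y} {xA : ℕ → ℝ → σ → ι → YA}
    (M L : ℕ) (hMtwo : 2 ≤ M) (hLtwo : 2 ≤ L) (planes : Finset (Fin 4 × Fin 4))
    (hplanes : ∀ P ∈ planes, P.1 ≠ P.2)
    (VA VB : ℕ → ℝ → σ → ι → (B7Prop1Explicit.Site 4 → Fin 4 → (Matrix n n ℂ)ˣ))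
    {a₀ a₁ a₂ ε₁ β₀ : ℝ}
    (hUR : ∀ K, URateUpTo K EA EB (gA K) (gB K) (uA K) (uB K) Adm Cr θ' κ) (hCr : 0 ≤ Cr)
    (hθ'0 : 0 < θ') (hθ'1 : θ' < 1) (hθ'Λ : θ' ≤ Λ) (hΛ1 : 1 ≤ Λ) (hCl : 0 ≤ Cl)
    (hURB : ∀ b ∈ C.admFl, ∀ K, URateUpTo K (atFl BA b) (atFl BB b) (gA K) (gB K) (uA K) (uB K) Adm EB₀ θ' κ)
    (hEB₀ : 0 ≤ EB₀)
    (hURR : ∀ K, URateUpTo K RA RB (gA K) (gB K) (uA K) (uB K) Adm CrR θ' κ) (hCrR : 0 ≤ CrR)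
    (hfmtA : ∀ K t τ, A K t τ = ∫ v, (∏ X ∈ fac K t τ,
      Real.exp (EA (gA K) (uA K v) X - EA (gA K) oneA X)) *
        ((∏ X ∈ bfac K t τ, Real.exp (BA (gA K) (uA K v) (pend K t τ v) X)) * nA K t τ v * qA K *
          ((∏ X ∈ rfac K t τ, Real.exp (RA (gA K) (uA K v) X - RA (gA K) oneA X)) * (Real.exp (-aA K t τ v) * wA K t τ v)))
          ∂(μ K t τ))
    (hfmtB : ∀ K t τ, B K t τ = ∫ v, (∏ X ∈ fac K t τ,
      Real.exp (EB (gB K) (uB K v) X - EB (gB K) oneB X)) *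
        ((∏ X ∈ bfac K t τ, Real.exp (BB (gB K) (uB K v) (pend K t τ v) X)) * nB K t τ v * qB K *
          ((∏ X ∈ rfac K t τ, Real.exp (RB (gB K) (uB K v) X - RB (gB K) oneB X)) * (Real.exp (-aB K t τ v) * wB K t τ v)))
          ∂(μ K t τ))
    (hint : ∀ K t, |t| ≤ l₀ → ∀ τ ∈ T K \ Bad K t,
      Integrable (fun v => (∏ X ∈ fac K t τ, Real.exp (EA (gA K) (uA K v) X - EA (gA K) oneA X)) *
        ((∏ X ∈ bfac K t τ, Real.exp (BA (gA K) (uA K v) (pend K t τ v) X)) * nA K t τ v * qA K *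
          ((∏ X ∈ rfac K t τ, Real.exp (RA (gA K) (uA K v) X - RA (gA K) oneA X)) * (Real.exp (-aA K t τ v) * wA K t τ v))))
          (μ K t τ) ∧
      Integrable (fun v => (∏ X ∈ fac K t τ, Real.exp (EB (gB K) (uB K v) X - EB (gB K) oneB X)) *
        ((∏ X ∈ bfac K t τ, Real.exp (BB (gB K) (uB K v) (pend K t τ v) X)) * nB K t τ v * qB K *
          ((∏ X ∈ rfac K t τ, Real.exp (RB (gB K) (uB K v) X - RB (gB K) oneB X)) * (Real.exp (-aB K t τ v) * wB K t τ v))))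
          (μ K t τ))
    (hsc : ∀ K t, |t| ≤ l₀ → ∀ τ ∈ T K \ Bad K t, ∀ X ∈ fac K t τ, C.scale X ≤ K)
    (hoff : ∀ K t, |t| ≤ l₀ → ∀ τ ∈ T K \ Bad K t, ∀ v, v ∉ Adm →
      (∏ X ∈ fac K t τ, Real.exp (EA (gA K) (uA K v) X - EA (gA K) oneA X)) *
        ((∏ X ∈ bfac K t τ, Real.exp (BA (gA K) (uA K v) (pend K t τ v) X)) * nA K t τ v * qA K *
          ((∏ X ∈ rfac K t τ, Real.exp (RA (gA K) (uA K v) X - RA (gA K) oneA X)) * (Real.exp (-aA K t τ v) * wA K t τ v)))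
          = 0 ∧
      (∏ X ∈ fac K t τ, Real.exp (EB (gB K) (uB K v) X - EB (gB K) oneB X)) *
        ((∏ X ∈ bfac K t τ, Real.exp (BB (gB K) (uB K v) (pend K t τ v) X)) * nB K t τ v * qB K *
          ((∏ X ∈ rfac K t τ, Real.exp (RB (gB K) (uB K v) X - RB (gB K) oneB X)) * (Real.exp (-aB K t τ v) * wB K t τ v)))
          = 0)
    (hS : ∀ K t, |t| ≤ l₀ → ∀ τ ∈ T K \ Bad K t, ∀ v ∈ Adm, ∀ j ≤ K,
      |(∑ X ∈ fac K t τ with C.scale X = j,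
          (Real.log (Real.exp (EB (gB K) (uB K v) X - EB (gB K) oneB X))
            - Real.log (Real.exp (EA (gA K) (uA K v) X - EA (gA K) oneA X)))) - κ₁ K t τ j| ≤ S K t τ j)
    (hM : ∀ K t, |t| ≤ l₀ → ∀ τ ∈ T K \ Bad K t,
      Multiplicity (fac K t τ) C.scale (fun X => Real.exp (-(κ * C.d X))) Cw vol Λ K)
    (hwit : ∀ K, ∃ v₁ ∈ Adm, uA K v₁ = oneA ∧ uB K v₁ = oneB)
    (hvol : 0 ≤ vol) (hE : 0 ≤ E) (ha0 : 0 < a) (ha1 : a < 1)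
    (hSle : ∀ K t, |t| ≤ l₀ → ∀ τ ∈ T K \ Bad K t, ∀ j ≤ K, S K t τ j ≤ vol * (E * a ^ (K - j)))
    (hpend : ∀ K t, |t| ≤ l₀ → ∀ τ ∈ T K \ Bad K t, ∀ v ∈ Adm, pend K t τ v ∈ C.admFl)
    (hBwin : ∀ K t, |t| ≤ l₀ → ∀ τ ∈ T K \ Bad K t, RecentOnly (bfac K t τ) C.scale (jlogOf Cl K) K)
    (hMB : ∀ K t, |t| ≤ l₀ → ∀ τ ∈ T K \ Bad K t,
      Multiplicity (bfac K t τ) C.scale (fun X => Real.exp (-(κ * C.d X))) Cw vol Λ K)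
    (hnpos : ∀ K t, |t| ≤ l₀ → ∀ τ ∈ T K \ Bad K t, ∀ v ∈ Adm, 0 < nA K t τ v ∧ 0 < nB K t τ v)
    (hzA : ∀ K t, |t| ≤ l₀ → ∀ τ ∈ T K \ Bad K t, ∀ v ∈ Adm, |Real.log (nA K t τ v)| ≤ vol * zA K)
    (hzB : ∀ K t, |t| ≤ l₀ → ∀ τ ∈ T K \ Bad K t, ∀ v ∈ Adm, |Real.log (nB K t τ v)| ≤ vol * zB K)
    (hzAs : Summable zA) (hzBs : Summable zB)
    (hq : ∀ K, 0 < qA K ∧ 0 < qB K)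
    -- the 𝐑-kind: scales, multiplicity, one-run slice sizes, the flow window of both coupling tables
    (hrsc : ∀ K t, |t| ≤ l₀ → ∀ τ ∈ T K \ Bad K t, ∀ X ∈ rfac K t τ, C.scale X ≤ K)
    (hMR : ∀ K t, |t| ≤ l₀ → ∀ τ ∈ T K \ Bad K t,
      Multiplicity (rfac K t τ) C.scale (fun X => Real.exp (-(κ * C.d X))) Cw vol Λ K)
    (hRSA : ∀ K t, |t| ≤ l₀ → ∀ τ ∈ T K \ Bad K t, ∀ v ∈ Adm, ∀ j ≤ K,
      |∑ X ∈ rfac K t τ with C.scale X = j, (RA (gA K) (uA K v) X - RA (gA K) oneA X)| ≤ vol * (R₁ * gsA K j ^ κ₀))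
    (hRSB : ∀ K t, |t| ≤ l₀ → ∀ τ ∈ T K \ Bad K t, ∀ v ∈ Adm, ∀ j ≤ K,
      |∑ X ∈ rfac K t τ with C.scale X = j, (RB (gB K) (uB K v) X - RB (gB K) oneB X)| ≤ vol * (R₁ * gsB K j ^ κ₀))
    (hb : 0 < b) (h031A : ∀ K, Step.Discrete031 b β' K (gfA K) (gsA K))
    (h031B : ∀ K, Step.Discrete031 b β' K (gfB K) (gsB K)) (hgsA : ∀ K k, k ≤ K → 0 ≤ gsA K k)
    (hgsB : ∀ K k, k ≤ K → 0 ≤ gsB K k) (hR₁ : 0 ≤ R₁) (hκ₀ : 4 < κ₀)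
    -- the ACTION kind from ONE CLASSICAL STEP: (min-A) (Q) (lift) (min-B) (act) (U) (L) (γ)
    (hminA : ∀ K t, |t| ≤ l₀ → ∀ τ ∈ T K \ Bad K t, ∀ v ∈ Adm, IsMinOn (g K t τ v) (SfibA K t τ v) (xA K t τ v))
    (hQ : ∀ K t, |t| ≤ l₀ → ∀ τ ∈ T K \ Bad K t, ∀ v ∈ Adm, Set.MapsTo (Q K t τ v) (Sfib K t τ v) (SfibA K t τ v))
    (hlift : ∀ K t, |t| ≤ l₀ → ∀ τ ∈ T K \ Bad K t, ∀ v ∈ Adm,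
      yA K t τ v ∈ Sfib K t τ v ∧ Q K t τ v (yA K t τ v) = xA K t τ v)
    (hminB : ∀ K t, |t| ≤ l₀ → ∀ τ ∈ T K \ Bad K t, ∀ v ∈ Adm,
      yB K t τ v ∈ Sfib K t τ v ∧ IsMinOn (f₁ K t τ v) (Sfib K t τ v) (yB K t τ v))
    (hact : ∀ K t, |t| ≤ l₀ → ∀ τ ∈ T K \ Bad K t, ∀ v ∈ Adm,
      aA K t τ v = w₀ * g K t τ v (xA K t τ v) + γA K t τ v ∧
        aB K t τ v = w₀ * f₁ K t τ v (yB K t τ v) + γB K t τ v)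
    (hw₀ : 0 ≤ w₀)
    -- (U)(L) PRODUCED for G = U(N) Wilson terms (`interpolation_averaging_UN_of_holderReg`): (repr) `hreprU hreprL`,
    -- unitarity/periodicity `hAU hBU`, LOCAL REGULARITY IN THE PRINTED HÖLDER CURRENCY about every site at spacing
    -- `(L^K)⁻¹` with constants `(a₀ε₁, a₁ε₁, a₂ε₁)` and exponent `0 < β₀ ≤ 1` (`hA9 hB9 hβ₀ hβ₀1`; the three `LocReg`
    -- radii, (44), (44∇), the smallness and both decay laws DERIVED), `ε₁ ≤ 1`, the smallness, `hε₁`, and `M⁴ ≤ vol`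
    (ha₀ : 0 ≤ a₀) (ha₁ : 0 ≤ a₁) (ha₂ : 0 ≤ a₂) (hε₁1 : ε₁ ≤ 1)
    (hsmall : 20480 * (L : ℝ) ^ 2 * (cReg a₀ a₁ * ε₁) ≤ 1)
    (hβ₀ : 0 < β₀) (hβ₀1 : β₀ ≤ 1)
    (hAU : ∀ K t, |t| ≤ l₀ → ∀ τ ∈ T K \ Bad K t, ∀ v ∈ Adm,
      (∀ x κ, VA K t τ v x κ ∈ unitaryUnits (Matrix n n ℂ)) ∧ IsPeriodic (M * L ^ K * L) (VA K t τ v))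
    (hBU : ∀ K t, |t| ≤ l₀ → ∀ τ ∈ T K \ Bad K t, ∀ v ∈ Adm,
      (∀ x κ, VB K t τ v x κ ∈ unitaryUnits (Matrix n n ℂ)) ∧ IsPeriodic (M * L ^ K * L) (VB K t τ v))
    (hA9 : ∀ K t, |t| ≤ l₀ → ∀ τ ∈ T K \ Bad K t, ∀ v ∈ Adm, ∀ z : B7Prop1Explicit.Site 4,
      HolderReg (VA K t τ v) z 6 (((L : ℝ) ^ K)⁻¹) (a₀ * ε₁) (a₁ * ε₁) β₀ (a₂ * ε₁))
    (hB9 : ∀ K t, |t| ≤ l₀ → ∀ τ ∈ T K \ Bad K t, ∀ v ∈ Adm, ∀ z : B7Prop1Explicit.Site 4,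
      HolderReg (VB K t τ v) z 6 (((L : ℝ) ^ K)⁻¹) (a₀ * ε₁) (a₁ * ε₁) β₀ (a₂ * ε₁))
    (hreprU : ∀ K t, |t| ≤ l₀ → ∀ τ ∈ T K \ Bad K t, ∀ v ∈ Adm,
      f₁ K t τ v (yA K t τ v) = ∑ x ∈ pbox planes (M * L ^ K * L), eN (phiU (VA K t τ v) x) ∧
        g K t τ v (xA K t τ v) = ∑ y ∈ pbox planes (M * L ^ K), eN (psiU L (VA K t τ v) y))
    (hreprL : ∀ K t, |t| ≤ l₀ → ∀ τ ∈ T K \ Bad K t, ∀ v ∈ Adm,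
      f₁ K t τ v (yB K t τ v) = ∑ x ∈ pbox planes (M * L ^ K * L), eN (phiU (VB K t τ v) x) ∧
        g K t τ v (Q K t τ v (yB K t τ v)) = ∑ y ∈ pbox planes (M * L ^ K), eN (psiU L (VB K t τ v) y))
    (hε₁ : 0 ≤ ε₁) (hMvol : ((M : ℝ)) ^ 4 ≤ vol)
    (hγ : ∀ K t, |t| ≤ l₀ → ∀ τ ∈ T K \ Bad K t, ∀ v ∈ Adm, |γB K t τ v - γA K t τ v| ≤ vol * rγ K)
    (hrγ : Summable rγ)
    -- the residual kind after generation 8: (R-w) radii about a centre `cW`, (W-w) the WITNESS log-ratio centred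
    (hwpos : ∀ K t, |t| ≤ l₀ → ∀ τ ∈ T K \ Bad K t, ∀ v ∈ Adm, 0 < wA K t τ v ∧ 0 < wB K t τ v)
    (hRw : ∀ K t, |t| ≤ l₀ → ∀ τ ∈ T K \ Bad K t, ∀ v ∈ Adm,
      |Real.log (wB K t τ v) - Real.log (wA K t τ v) - cW K t τ| ≤ RW K t τ)
    (hRRw : ∀ K t, |t| ≤ l₀ → ∀ τ ∈ T K \ Bad K t, RW K t τ ≤ vol * rw K) (hrw : Summable rw)
    (hWw : ∀ K t, |t| ≤ l₀ → ∀ τ ∈ T K \ Bad K t, ∀ v ∈ Adm, uA K v = oneA → uB K v = oneB →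
      |Real.log (wB K t τ v) - Real.log (wA K t τ v) - c₀ K| ≤ vol * sw K)
    (hsw : Summable sw) :
    GoodClause l₀ vol T A B Bad
        (fun K => (max Cw 1 * ((E + Cr) * ∑ x ∈ antidiagonal K, min (a ^ x.2) (θ' ^ x.1 * Λ ^ x.2))
            + (EB₀ * Cw * windowSum θ' Λ (jlogOf Cl K) K + (zA K + zB K)
              + (max (2 * Cw) 1 * ((∑ p ∈ antidiagonal K, min (R₁ * gsA K p.1 ^ κ₀) (CrR * θ' ^ p.1 * Λ ^ p.2))
                  + ∑ p ∈ antidiagonal K, min (R₁ * gsB K p.1 ^ κ₀) (CrR * θ' ^ p.1 * Λ ^ p.2))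
                + (w₀ * (dUP (Fintype.card n) L planes.card (cReg a₀ a₁) (cOscReg L a₀ a₁ a₂) ε₁ (fun K => ((L : ℝ) ^ (-β₀)) ^ K) K + dLN (Fintype.card n) L planes.card (cReg a₀ a₁) ε₁ K)
                  + rγ K + rw K))))
          + (max Cw 1 * ((E + Cr) * ∑ x ∈ antidiagonal K, min (a ^ x.2) (θ' ^ x.1 * Λ ^ x.2)) + (rw K + sw K))) ∧
      Summable (fun K => (max Cw 1 * ((E + Cr) * ∑ x ∈ antidiagonal K, min (a ^ x.2) (θ' ^ x.1 * Λ ^ x.2))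
            + (EB₀ * Cw * windowSum θ' Λ (jlogOf Cl K) K + (zA K + zB K)
              + (max (2 * Cw) 1 * ((∑ p ∈ antidiagonal K, min (R₁ * gsA K p.1 ^ κ₀) (CrR * θ' ^ p.1 * Λ ^ p.2))
                  + ∑ p ∈ antidiagonal K, min (R₁ * gsB K p.1 ^ κ₀) (CrR * θ' ^ p.1 * Λ ^ p.2))
                + (w₀ * (dUP (Fintype.card n) L planes.card (cReg a₀ a₁) (cOscReg L a₀ a₁ a₂) ε₁ (fun K => ((L : ℝ) ^ (-β₀)) ^ K) K + dLN (Fintype.card n) L planes.card (cReg a₀ a₁) ε₁ K)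
                  + rγ K + rw K))))
          + (max Cw 1 * ((E + Cr) * ∑ x ∈ antidiagonal K, min (a ^ x.2) (θ' ^ x.1 * Λ ^ x.2)) + (rw K + sw K))) := by
  have hL1 : 1 ≤ L := le_trans one_le_two hLtwo
  exact goodClause_summable_UN_of_locRegHolder (Sfib := Sfib) (SfibA := SfibA) (g := g) (f₁ := f₁) (Q := Q)
    (yA := yA) (yB := yB) (xA := xA) M L hMtwo hLtwo planes hplanes VA VB hUR
    hCr hθ'0 hθ'1 hθ'Λ hΛ1 hCl hURB hEB₀ hURR hCrR hfmtA hfmtB hint hsc hoff hS hM hwit hvol hE ha0 ha1 hSle hpend hBwin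
    hMB hnpos hzA hzB hzAs hzBs hq hrsc hMR hRSA hRSB hb h031A h031B hgsA hgsB hR₁ hκ₀ hminA hQ hlift hminB hact hw₀ ha₀
    ha₁ ha₂ hε₁1 hsmall hβ₀ hβ₀1 hAU hBU
    (fun K t ht τ hτ v hv z => (hA9 K t ht τ hτ v hv z).locReg_level hL1 K)
    (fun K t ht τ hτ v hv z => (hB9 K t ht τ hτ v hv z).locReg_level hL1 K)
    hreprU hreprL hε₁ hMvol hγ hrγ hwpos hRw hRRw hrw hWw hsw

end Ledger

section Toy

/-- §12 TOY.  The constant `U(3)` configuration satisfies `hAU`/`hA9` of §11 at every scale with constants `0`, every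
spacing and exponent, and the smallness holds at `L = 2`: the hypothesis set of §11 is satisfiable. [folklore] -/
theorem const_config_holderReg_U3 (Np : ℕ) (z : B7Prop1Explicit.Site 4) (K : ℕ) (ε₁ β₀ : ℝ) :
    (∀ (x : B7Prop1Explicit.Site 4) (κ : Fin 4),
        (fun (_ : B7Prop1Explicit.Site 4) (_ : Fin 4) => (1 : (Matrix (Fin 3) (Fin 3) ℂ)ˣ)) x κ
          ∈ unitaryUnits (Matrix (Fin 3) (Fin 3) ℂ)) ∧
      IsPeriodic Np (fun (_ : B7Prop1Explicit.Site 4) (_ : Fin 4) => (1 : (Matrix (Fin 3) (Fin 3) ℂ)ˣ)) ∧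
      HolderReg (fun (_ : B7Prop1Explicit.Site 4) (_ : Fin 4) => (1 : (Matrix (Fin 3) (Fin 3) ℂ)ˣ)) z 6
        ((((2 : ℕ) : ℝ) ^ K)⁻¹) (0 * ε₁) (0 * ε₁) β₀ (0 * ε₁) ∧
      20480 * ((2 : ℕ) : ℝ) ^ 2 * (cReg 0 0 * ε₁) ≤ 1 := by
  refine ⟨fun _ _ => Subgroup.one_mem _, fun _ _ => rfl, ?_, by simp [cReg]⟩
  simpa using holderReg_one (𝔸 := Matrix (Fin 3) (Fin 3) ℂ) z 6 ((((2 : ℕ) : ℝ) ^ K)⁻¹) β₀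

end Toy

end Summit.QuantumFields.BalabanUV.T4Continuum.TermwiseHolder
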